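import Literature.AnabelianGeometry.SemiGraphs.TemperedVerticial
import Literature.Topology.Algebra.OpenNormalBasisResiduallyFinite
import HarnessLib

/-!
# [SemiAnbd] Proposition 3.6 (iii): `π₁^temp(G) ↪ π̂₁(G)` — reduction to the cofinal Galois system

Proof-only companion to `TemperedVerticial.lean` (abc-iut cell, layer L3, G10 rung 2, node
SemiAnbd:Prop3.6(iii)).  Mochizuki, *Semi-graphs of anabelioids*, Publ. RIMS 42 (2006), proof of
Prop. 3.6 (iii), p. 39: "`π₁^temp(G)` may be identified with the inverse limit of the
`Gal(H'_i/G)` … each `Gal(H'_i/G)` [an extension of a finite group by a free group] is residually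
finite, so `π₁^temp(G)` injects into its profinite completion."  This file performs the SOFT half of
that argument for an arbitrary chart `c : TemperedPiChart 𝒢`: if the open normal subgroups `N` of
`c.G` with residually finite quotient `c.G/N` are cofinal among all open normal subgroups (the
content supplied by the cofinal system `H'_i` = finite étale Galois ∘ universal graph-covering,
G10 rung 1), then the open normal subgroups of FINITE index separate the points of `c.G`, i.e. the
named fact `TemperedPiResiduallyFinite` holds.  The cofinality input is taken as an explicit
hypothesis (no new named fact); its discharge is the sequel.
-/

namespace Literature.AnabelianGeometry.SemiGraphs

namespace ProfiniteSemiGraph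

open Literature.Topology.Algebra

universe u

/-- **Prop. 3.6 (iii) from the cofinal residually-finite Galois system** ([SemiAnbd] p. 39): if,
for every semi-graph of anabelioids `𝒢` satisfying the hypotheses of Prop. 3.6 and every chart `c`
of its tempered fundamental group, every open normal subgroup `N₀` of `c.G` contains an open normal
subgroup `N` with `c.G/N` residually finite, then `TemperedPiResiduallyFinite` holds: for `g ≠ 1`,
temperedness gives an open normal `N₀ ∌ g`, the hypothesis an `N ≤ N₀` with residually finite
quotient, in which the image of `g` is separated by a finite-index normal subgroup, whose pull-back
is open, normal, of finite index and misses `g`. [cite: MochizukiSemiAnbd2006, Prop 3.6(iii) p.39] -/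
theorem temperedPiResiduallyFinite_of_cofinal
    (hcof : ∀ (𝒢 : ProfiniteSemiGraph.{u}), 𝒢.Prop36Hypotheses → ∀ (c : TemperedPiChart 𝒢)
      (N₀ : OpenNormalSubgroup c.G), ∃ N : OpenNormalSubgroup c.G,
        N.toSubgroup ≤ N₀.toSubgroup ∧ Group.ResiduallyFinite (c.G ⧸ N.toSubgroup)) :
    TemperedPiResiduallyFinite.{u} := by
  intro 𝒢 h𝒢 c g hg
  obtain ⟨N₀, hg₀⟩ := c.isTempered.separated g hg
  obtain ⟨N, hle, hN⟩ := hcof 𝒢 h𝒢 c N₀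
  have hgN : g ∉ N := fun h => hg₀ (hle h)
  have hgbar : (QuotientGroup.mk g : c.G ⧸ N.toSubgroup) ≠ 1 := fun h =>
    hgN ((QuotientGroup.eq_one_iff g).mp h)
  haveI := hN
  obtain ⟨M, hM⟩ := Group.exists_finiteIndexNormalSubgroup_notMem _ hgbar
  obtain ⟨K, hK, hKfi⟩ := exists_openNormalSubgroup_comap N M
  haveI := hKfi
  refine ⟨K, Subgroup.finite_quotient_of_finiteIndex, fun h => hM ?_⟩
  have h' : g ∈ K.toSubgroup := h
  rw [hK] at h'
  exact h'

end ProfiniteSemiGraph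

end Literature.AnabelianGeometry.SemiGraphs
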